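import Summits.NavierStokesRegularity.NavierStokesRegularity.Theorems.NoOverheating.Negative.ExcludedStrataCensus
import Summits.NavierStokesRegularity.NavierStokesRegularity.Theorems.NoOverheating.Negative.SelfSimilarWindowsExcluded

/-!
# KJ-41 — CENSUS v2 of the excluded strata of route `AngularGalerkinLadder`'s window sequences
# ((S0)–(S4) of `excludedStrata_windowSequences` + (S5) hidden plain-DSS factor / exactly
# self-similar profiles, circuit lineage `SelfSimilarWindowsExcluded`)

Refuter lineage, Negative lane of crux K2 `NoOverheating` (supports, does not decide).  This file
proves NOTHING new about fluids: it folds stratum (S5) — `no_windowSequence_extraFineFactor` (a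
common HIDDEN plain-DSS factor `1 < λ < λ₁(C₀)`, whatever the declared factors and rotations;
Chae–Wolf 2017 Thm 1.3 on the cut-off ladder limit) and `no_selfSimilar_windowSequence` (exactly
self-similar profiles, no threshold) — into the one census statement of record, so that planners,
tribunal and census cite ONE decl, `excludedStrata_windowSequences_v2`, for "what an admissible
window sequence of K2 can NOT be".  Stratum (S6) (hidden ROTATED self-similarity in Pineau–Vicol's
regimes, `HiddenRSSWindowsExcluded`) and the window-level mixed form (`MixedStrataExcluded`) stay
separate decls.  WHAT ESCAPES: `C₀ > ε₀` with genuinely discrete RDSS whose usable powers twist in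
Pineau–Vicol's open middle range or meet only coarse windows, with no hidden factor below `λ₁(C₀)`.
WHAT THIS IS NOT: not `¬NoOverheating`; no new Literature fact, no definition; standard axioms only.
[cite: KochNadirashviliSereginSverak2009, Theorems 1.2–1.3]
[cite: ChaeWolf2017RemovingDSS, Theorem 1.3 (arXiv:1610.09464 p. 3)]
[cite: PineauVicol2026, Theorem 1.7 (i)–(ii) (arXiv:2607.09619 p. 7)] -/

namespace Summit.NavierStokesRegularity.AngularGalerkinLadderExcludedStrataCensusV2

open Set Filter MeasureTheory Topology Function
open Literature.Analysis Literature.Analysis.FluidPDE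
open Summit.NavierStokesRegularity.FluidComputer
open Summit.NavierStokesRegularity.NavierStokesRegularity.Theses.AngularGalerkinLadder
open Summit.NavierStokesRegularity.AngularGalerkinLadderExcludedStrataCensus
open Summit.NavierStokesRegularity.AngularGalerkinLadderSelfSimilarWindowsExcluded

/-- **Census theorem v2: the excluded strata (S0)–(S5) of K2's window sequences.**  As
`excludedStrata_windowSequences`, plus: (S5a) a common HIDDEN plain-DSS factor `1 < λ < λ₁(C₀)`
(`no_windowSequence_extraFineFactor`), (S5b) exactly self-similar profiles
(`no_selfSimilar_windowSequence`) — both for ANY window and ANY rotations.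
[cite: ChaeWolf2017RemovingDSS, Theorem 1.3]
[cite: PineauVicol2026, Theorem 1.7 (i)–(ii)] -/
theorem excludedStrata_windowSequences_v2 :
    ∃ ε₀ : ℝ, 0 < ε₀ ∧ ∀ C₀ : ℝ, ∃ κ α₁ c₁ α₂ c₂ lam₁ : ℝ,
      1 < κ ∧ 0 < α₁ ∧ 1 < c₁ ∧ 0 < α₂ ∧ 1 < c₂ ∧ 1 < lam₁ ∧
      ∀ {cmin cmax δ : ℝ} {L : ℕ → ℕ} {ε c : ℕ → ℝ}
        {R : ℕ → (EuclideanSpace ℝ (Fin 3) ≃ₗᵢ[ℝ] EuclideanSpace ℝ (Fin 3))}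
        {u : ℕ → ℝ → EuclideanSpace ℝ (Fin 3) → EuclideanSpace ℝ (Fin 3)}
        {p : ℕ → ℝ → EuclideanSpace ℝ (Fin 3) → ℝ}
        {d : ℕ → ℝ → EuclideanSpace ℝ (Fin 3) → EuclideanSpace ℝ (Fin 3)},
        1 < cmin → 0 < δ → Tendsto ε atTop (𝓝 0) →
        (∀ n, AngularLadder.IsWindowProfile (L n) C₀ cmin cmax δ (ε n) (c n) (R n) (u n) (p n)
          (d n)) →
        ¬ (C₀ ≤ ε₀ ∨
           (∀ n, ∀ t < 0, IsAxisymmetric (u n t)) ∨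
           (∃ q : ℕ, 0 < q ∧ cmax ^ q < κ ∧
              ∀ x, Tendsto (fun n => ((R n) ^ q) x) atTop (𝓝 x)) ∨
           (∃ (q : ℕ) (g : ℕ → (EuclideanSpace ℝ (Fin 3) ≃ₗᵢ[ℝ] EuclideanSpace ℝ (Fin 3)))
              (θ : ℕ → ℝ),
              0 < q ∧ cmax ^ q < c₁ ∧ (∀ n x, ((R n) ^ q) x = g n (rotZ (θ n) ((g n).symm x))) ∧
              ∀ n, |θ n| ≤ 2 * α₁ * (q * Real.log (c n))) ∨
           (∃ (Θ ℓ : ℝ) (g : ℕ → (EuclideanSpace ℝ (Fin 3) ≃ₗᵢ[ℝ] EuclideanSpace ℝ (Fin 3)))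
              (θ : ℕ → ℝ),
              ℓ < Real.log c₂ ∧ (∀ n x, R n x = g n (rotZ (θ n) ((g n).symm x))) ∧
              (∀ n, |θ n| ≤ Θ) ∧ (∀ n, 2 * α₂ * Real.log (c n) ≤ |θ n|) ∧
              ∀ n, (1 + (θ n / (2 * Real.log (c n))) ^ 2) * Real.log (c n) ≤ ℓ) ∨
           (∃ lam : ℝ, 1 < lam ∧ lam < lam₁ ∧ ∀ n, IsDiscretelySelfSimilar lam (u n)) ∨
           (∀ n, IsSelfSimilar (u n))) := by
  obtain ⟨ε₀, hε₀, H⟩ := excludedStrata_windowSequences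
  refine ⟨ε₀, hε₀, fun C₀ => ?_⟩
  obtain ⟨κ, α₁, c₁, α₂, c₂, hκ, hα₁, hc₁, hα₂, hc₂, HC⟩ := H C₀
  obtain ⟨lam₁, hlam₁, H5⟩ := no_windowSequence_extraFineFactor C₀
  refine ⟨κ, α₁, c₁, α₂, c₂, lam₁, hκ, hα₁, hc₁, hα₂, hc₂, hlam₁,
    fun {cmin cmax δ L ε c R u p d} hcmin hδ hε hW => ?_⟩
  rintro (h0 | h1 | h2 | h3 | h4 | ⟨lam, hlam, hlamc, hss⟩ | h6)
  · exact HC hcmin hδ hε hW (Or.inl h0)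
  · exact HC hcmin hδ hε hW (Or.inr (Or.inl h1))
  · exact HC hcmin hδ hε hW (Or.inr (Or.inr (Or.inl h2)))
  · exact HC hcmin hδ hε hW (Or.inr (Or.inr (Or.inr (Or.inl h3))))
  · exact HC hcmin hδ hε hW (Or.inr (Or.inr (Or.inr (Or.inr h4))))
  · exact H5 hlam hlamc hcmin hδ hε hW hss
  · exact no_selfSimilar_windowSequence hcmin hδ hε hW h6

end Summit.NavierStokesRegularity.AngularGalerkinLadderExcludedStrataCensusV2
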